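import Mathlib
import HarnessLib
import Literature.NumberTheory.Transcendental.KZCalculus
import Literature.NumberTheory.Transcendental.SemialgebraicLineDeriv
import Summits.KontsevichZagierPeriods.KontsevichZagierPeriods.Theses.LinRedNormalForm
import Summits.KontsevichZagierPeriods.KontsevichZagierPeriods.Theorems.LinRedNormalFormDihedralNormalFormStubWordAtomChart
import Summits.KontsevichZagierPeriods.KontsevichZagierPeriods.Theorems.LinRedNormalFormDihedralNormalFormStubAtomReductionAux2
import Summits.KontsevichZagierPeriods.KontsevichZagierPeriods.Theorems.LinRedNormalFormDihedralNormalFormStubAtomReductionAux5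
import Summits.KontsevichZagierPeriods.KontsevichZagierPeriods.Theorems.LinRedNormalFormDihedralNormalFormStubTorusDescentAux1

/-!
# Crux `DihedralNormalForm` (stmt-KontsevichZagierPeriods-3912), line `torus-descent-sum-shadow`:
# stub `stub_chartBack`

The cubical chart read BACKWARDS.  A convergent cubical atom
`[□ᵏ, q · xᵃ · ∏_{i ≤ j} (1 - x_{[i,j]})^{e i j}]` (`x_{[i,j]} = xᵢ ⋯ xⱼ`, open cube `(0,1)ᵏ`;
the kernel is `TorusDescent.atomFun a e`) is congruent modulo `KZ.relations`, by ONE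
change-of-variables move (Kontsevich–Zagier's rule (2)) along the monomial chart `tᵢ = x₀ ⋯ xᵢ`
of the open ordered simplex `Δ_k = {1 > t₀ > ⋯ > t_{k-1} > 0}` (`TwoPosets.cubicalMap`), to a
convergent SIMPLICIAL LAURENT MONOMIAL representation
`[Δ_k, q · ∏ tᵢ^{βᵢ} (1 - tᵢ)^{γᵢ} ∏_{i<j} (tᵢ - tⱼ)^{αᵢⱼ}]`.

The exponents are read off the three dictionary entries of the chart on the open cube
(`y ∈ (0,1)ᵏ`, `Pᵢ = y₀ ⋯ yᵢ = TwoPosets.pprod y i`):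
* `1 - x_{[0,j]} = 1 - Pⱼ` (`AtomReduction.cp_zero_eq`), whence `γⱼ = e 0 j`;
* `Pᵢ - Pⱼ = Pᵢ · (1 - x_{[i+1,j]})` for `i < j` (`AtomReduction.pprod_sub_pprod`), whence
  `αᵢⱼ = e (i+1) j` (and `0` in the empty last row) and a compensating power `Pᵢ^{-Σ_{j>i} αᵢⱼ}`;
* `y₀ = P₀`, `y_{i+1} = P_{i+1}/Pᵢ` (`TwoPosets.eq_pprod_succ_div`), whence
  `∏ y_l^{c_l} = ∏ Pᵢ^{cᵢ - c_{i+1}}` (`prod_zpow_telescope`, `c_k = 0`), applied to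
  `c_l = a_l - (k-1-l)`, the exponent of `xᵃ` divided by the Jacobian `∏ y_l^{k-1-l}` of the
  chart (`AtomReduction.abs_jacobian_eq`); so `βᵢ = cᵢ - c_{i+1} - Σ_{j>i} αᵢⱼ`.
Shifted sequences `i ↦ c_{i+1}` are written `Fin.snoc (fun i' => c i'.succ) 0`.  With these,
`q · atomFun a e y = q · mono(P(y)) · |Jac(y)|` on the open cube (`atom_eq_smono_mul_jacobian`);
the simplicial representation is assembled from the integrability transport
`wordAtomChart_integrableOn_image` and the arithmetic closure lemmas of `IsSemialgebraicFunOn`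
(`isSemialgebraicFunOn_smono`), and the congruence is the monomial-chart transport theorem
`FurushoPentagon.HoffmanRelationInKZ.monomialChart_transport` (one `KZ.changeOfVariablesRel`
move).  Dimension `0` is degenerate (both sides are the constant `q` on a point).  The file
introduces no definitions.

References: M. Kontsevich, D. Zagier, *Periods* (2001), §1.2 rule (2); F. Brown, *Multiple zeta
values and periods of moduli spaces `𝔐_{0,n}`*, Ann. Sci. ÉNS 42 (2009), §2 (cubical versus
simplicial coordinates).
-/

noncomputable section

open MeasureTheory Set
open Literature.NumberTheory.Transcendental
open Literature.ModelTheory.ExponentialFields (IsSemialgebraic)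

namespace Summit.KontsevichZagierPeriods.DihedralNormalForm.TorusDescent

open Summit.KontsevichZagierPeriods.MzvKernelInKZ.TwoPosets
open Summit.KontsevichZagierPeriods.FurushoPentagon.HoffmanRelationInKZ (monomialChart_transport)

namespace ChartBack

variable {n : ℕ}

/-! ### The three dictionary entries of the chart -/

/-- Chord products split by their first index: the row `i = 0` gives the letters `1 - Pⱼ`
(`Pⱼ = y₀ ⋯ yⱼ`); the rows `i = i' + 1`, re-indexed by `i' : Fin n`, keep their chords, with the
(definitionally equal) condition `i'.castSucc < j`. [folklore] -/
theorem chord_prod_split (e : Fin (n + 1) → Fin (n + 1) → ℤ) (y : Fin (n + 1) → ℝ) :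
    (∏ i : Fin (n + 1), ∏ j : Fin (n + 1), if i ≤ j then
        (1 - (∏ l : Fin (n + 1), if i ≤ l ∧ l ≤ j then y l else 1)) ^ e i j else (1:ℝ)) =
      (∏ j : Fin (n + 1), (1 - pprod y j) ^ e 0 j) *
        ∏ i' : Fin n, ∏ j : Fin (n + 1), if i'.castSucc < j then
          (1 - (∏ l : Fin (n + 1), if i'.succ ≤ l ∧ l ≤ j then y l else 1)) ^ e i'.succ j
          else (1:ℝ) := by
  -- the rows `i' + 1` agree definitionally (`i'.succ ≤ j ↔ i'.castSucc < j`); the row `0`: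
  rw [Fin.prod_univ_succ]
  congr 1
  refine Finset.prod_congr rfl fun j _ => ?_
  rw [if_pos (Fin.zero_le _), AtomReduction.cp_zero_eq]
  rfl

/-- Differences of partial products as powers of partial products times chords:
`∏_{i<j} (Pᵢ - Pⱼ)^{αᵢⱼ} = ∏ᵢ Pᵢ^{Σ_{j>i} αᵢⱼ} · ∏_{i'<j} (1 - y_{i'+1} ⋯ yⱼ)^{α_{i' j}}`
(`Pᵢ - Pⱼ = Pᵢ (1 - y_{i+1}⋯yⱼ)`, `AtomReduction.pprod_sub_pprod`; the last row is empty).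
[folklore] -/
theorem diff_prod_split (α : Fin (n + 1) → Fin (n + 1) → ℤ) {y : Fin (n + 1) → ℝ}
    (hy : ∀ l, y l ≠ 0) :
    (∏ i : Fin (n + 1), ∏ j : Fin (n + 1),
        if i < j then (pprod y i - pprod y j) ^ α i j else (1:ℝ)) =
      (∏ i : Fin (n + 1), pprod y i ^ (∑ j : Fin (n + 1), if i < j then α i j else 0)) *
        ∏ i' : Fin n, ∏ j : Fin (n + 1), if i'.castSucc < j then
          (1 - (∏ l : Fin (n + 1), if i'.succ ≤ l ∧ l ≤ j then y l else 1)) ^ α i'.castSucc j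
          else (1:ℝ) := by
  have hP : ∀ i, pprod y i ≠ 0 := pprod_ne_zero hy
  have hE : ∀ i : Fin (n + 1), (∏ j : Fin (n + 1), if i < j then pprod y i ^ α i j else (1:ℝ)) =
      pprod y i ^ (∑ j : Fin (n + 1), if i < j then α i j else 0) := by
    intro i
    rw [AtomReduction.zpow_finset_sum _ _ (hP i)]
    refine Finset.prod_congr rfl fun j _ => ?_
    split_ifs
    · rfl
    · rw [zpow_zero]
  have hlast : (∏ j : Fin (n + 1), if Fin.last n < j then
      (pprod y (Fin.last n) - pprod y j) ^ α (Fin.last n) j else (1:ℝ)) = 1 :=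
    Finset.prod_eq_one fun j _ => if_neg (not_lt.2 (Fin.le_last j))
  have hElast : (∑ j : Fin (n + 1), if Fin.last n < j then α (Fin.last n) j else 0) = 0 :=
    Finset.sum_eq_zero fun j _ => if_neg (not_lt.2 (Fin.le_last j))
  rw [Fin.prod_univ_castSucc, hlast, mul_one,
    Fin.prod_univ_castSucc (fun i => pprod y i ^ (∑ j : Fin (n + 1), if i < j then α i j else 0)),
    hElast, zpow_zero, mul_one, ← Finset.prod_mul_distrib]
  refine Finset.prod_congr rfl fun i' _ => ?_
  rw [← hE, ← Finset.prod_mul_distrib]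
  refine Finset.prod_congr rfl fun j _ => ?_
  split_ifs with hij
  · rw [← mul_zpow]
    congr 1
    exact AtomReduction.pprod_sub_pprod i' j hij y
  · rw [mul_one]

/-- Telescoping the inverse chart `y₀ = P₀`, `y_{i+1} = P_{i+1} / Pᵢ`:
`∏_l y_l^{c_l} = ∏ᵢ Pᵢ^{cᵢ - c_{i+1}}` (`c_{n+1} = 0`). [folklore] -/
theorem prod_zpow_telescope (c : Fin (n + 1) → ℤ) {y : Fin (n + 1) → ℝ} (hy : ∀ l, y l ≠ 0) :
    (∏ l : Fin (n + 1), y l ^ c l) = ∏ i : Fin (n + 1), pprod y i ^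
      (c i - (Fin.snoc (fun i' : Fin n => c i'.succ) (0:ℤ) : Fin (n + 1) → ℤ) i) := by
  have hP : ∀ i, pprod y i ≠ 0 := pprod_ne_zero hy
  have h1 : (∏ i : Fin (n + 1), pprod y i ^
      (c i - (Fin.snoc (fun i' : Fin n => c i'.succ) (0:ℤ) : Fin (n + 1) → ℤ) i)) =
      (∏ i : Fin (n + 1), pprod y i ^ c i) / ∏ i' : Fin n, pprod y i'.castSucc ^ c i'.succ := by
    simp only [zpow_sub₀ (hP _), Finset.prod_div_distrib]
    congr 1
    rw [Fin.prod_univ_castSucc]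
    simp only [Fin.snoc_castSucc, Fin.snoc_last, zpow_zero, mul_one]
  have h2 : (∏ l : Fin (n + 1), y l ^ c l) =
      (∏ i : Fin (n + 1), pprod y i ^ c i) / ∏ i' : Fin n, pprod y i'.castSucc ^ c i'.succ := by
    rw [Fin.prod_univ_succ, Fin.prod_univ_succ (fun i => pprod y i ^ c i), pprod_zero,
      mul_div_assoc, ← Finset.prod_div_distrib]
    congr 1
    refine Finset.prod_congr rfl fun i' _ => ?_
    rw [eq_pprod_succ_div hy i', div_zpow]
  rw [h1, h2]

/-- **Power bookkeeping of the chart.** For every `E`,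
`yᵃ = ∏ᵢ Pᵢ^{cᵢ - c_{i+1} - Eᵢ} · ∏ᵢ Pᵢ^{Eᵢ} · ∏_l y_l^{n-l}` with `c_l = a_l - (n - l)`
(the last factor is the Jacobian of the chart, `prod_zpow_telescope` does the rest). [folklore] -/
theorem prod_pow_eq (a : Fin (n + 1) → ℕ) (E : Fin (n + 1) → ℤ) {y : Fin (n + 1) → ℝ}
    (hy : ∀ l, y l ≠ 0) :
    (∏ l : Fin (n + 1), y l ^ a l) =
      ((∏ i : Fin (n + 1), pprod y i ^
          ((((a i : ℕ) : ℤ) - ((n + 1 - 1 - (i : ℕ) : ℕ) : ℤ)) -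
            (Fin.snoc (fun i' : Fin n =>
              ((a i'.succ : ℕ) : ℤ) - ((n + 1 - 1 - (i'.succ : ℕ) : ℕ) : ℤ)) (0:ℤ) :
                Fin (n + 1) → ℤ) i - E i)) *
        ∏ i : Fin (n + 1), pprod y i ^ E i) *
      ∏ l : Fin (n + 1), y l ^ (n + 1 - 1 - (l : ℕ)) := by
  calc (∏ l : Fin (n + 1), y l ^ a l)
      = ∏ l : Fin (n + 1), (y l ^ (((a l : ℕ) : ℤ) - ((n + 1 - 1 - (l : ℕ) : ℕ) : ℤ)) *
          y l ^ (n + 1 - 1 - (l : ℕ))) := by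
        refine Finset.prod_congr rfl fun l _ => ?_
        rw [← zpow_natCast (y l) (n + 1 - 1 - (l : ℕ)), ← zpow_add₀ (hy l), ← zpow_natCast,
          sub_add_cancel]
    _ = (∏ l : Fin (n + 1), y l ^ (((a l : ℕ) : ℤ) - ((n + 1 - 1 - (l : ℕ) : ℕ) : ℤ))) *
          ∏ l : Fin (n + 1), y l ^ (n + 1 - 1 - (l : ℕ)) := Finset.prod_mul_distrib
    _ = _ := by
        congr 1
        rw [prod_zpow_telescope _ hy, ← Finset.prod_mul_distrib]
        refine Finset.prod_congr rfl fun i _ => ?_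
        rw [← zpow_add₀ (pprod_ne_zero hy i), sub_add_cancel]

/-! ### The pulled-back atom is the simplicial monomial times the Jacobian -/

/-- **The chart identity on the open cube.** With `P = cubicalMap (n+1) y` (`Pᵢ = y₀⋯yᵢ`),
`c_l = a_l - (n - l)`, `αᵢⱼ = e (i+1) j` (`0` in the last row), `βᵢ = cᵢ - c_{i+1} - Σ_{j>i} αᵢⱼ`:
`q · atomFun a e y = q · ∏ Pᵢ^{βᵢ} (1 - Pᵢ)^{e 0 i} ∏_{i<j} (Pᵢ - Pⱼ)^{αᵢⱼ} · |Jac(y)|`, the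
Jacobian of the monomial chart with rows `{j ≤ i}` being `∏ y_l^{n-l}`.
[cite: KontsevichZagier2001, §1.2 rule (2)] -/
theorem atom_eq_smono_mul_jacobian (q : ℚ) (a : Fin (n + 1) → ℕ)
    (e : Fin (n + 1) → Fin (n + 1) → ℤ) {y : Fin (n + 1) → ℝ} (hy : ∀ i, y i ∈ Ioo (0:ℝ) 1) :
    (q : ℝ) * atomFun a e y =
      (q : ℝ) * ((∏ i : Fin (n + 1), cubicalMap (n + 1) y i ^
            ((((a i : ℕ) : ℤ) - ((n + 1 - 1 - (i : ℕ) : ℕ) : ℤ)) -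
              (Fin.snoc (fun i' : Fin n =>
                ((a i'.succ : ℕ) : ℤ) - ((n + 1 - 1 - (i'.succ : ℕ) : ℕ) : ℤ)) (0:ℤ) :
                  Fin (n + 1) → ℤ) i -
              ∑ j : Fin (n + 1), if i < j then
                (Fin.snoc (fun i' : Fin n => e i'.succ j) (0:ℤ) : Fin (n + 1) → ℤ) i else 0)) *
          (∏ i : Fin (n + 1), (1 - cubicalMap (n + 1) y i) ^ e 0 i) *
          ∏ i : Fin (n + 1), ∏ j : Fin (n + 1), if i < j then
            (cubicalMap (n + 1) y i - cubicalMap (n + 1) y j) ^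
              (Fin.snoc (fun i' : Fin n => e i'.succ j) (0:ℤ) : Fin (n + 1) → ℤ) i
            else (1:ℝ)) *
        |∏ i, ∏ l ∈ (Finset.univ.filter (fun j => j ≤ i)).erase i, y l| := by
  have hy0 : ∀ l, y l ≠ 0 := fun l => (hy l).1.ne'
  unfold atomFun
  simp only [cubicalMap_apply]
  rw [AtomReduction.abs_jacobian_eq hy, chord_prod_split e y, diff_prod_split _ hy0,
    prod_pow_eq a (fun i => ∑ j : Fin (n + 1), if i < j then
      (Fin.snoc (fun i' : Fin n => e i'.succ j) (0:ℤ) : Fin (n + 1) → ℤ) i else 0) hy0]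
  simp only [Fin.snoc_castSucc]
  ring

/-! ### Semialgebraicity of simplicial Laurent monomials -/

/-- A simplicial Laurent monomial `q · ∏ tᵢ^{βᵢ} (1 - tᵢ)^{γᵢ} ∏_{i<j} (tᵢ - tⱼ)^{αᵢⱼ}` (integer
exponents, Mathlib's junk value `0⁻¹ = 0` included) is a `ℚ`-semialgebraic function on every
`ℚ`-semialgebraic set. [cite: BochnakCosteRoy1998, Prop. 2.2.6] -/
theorem isSemialgebraicFunOn_smono {k : ℕ} {S : Set (Fin k → ℝ)} (hS : IsSemialgebraic ℚ S)
    (q : ℚ) (β γ : Fin k → ℤ) (α : Fin k → Fin k → ℤ) :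
    IsSemialgebraicFunOn ℚ S (fun t => (q : ℝ) * ((∏ i : Fin k, t i ^ β i) *
      (∏ i : Fin k, (1 - t i) ^ γ i) *
      ∏ i : Fin k, ∏ j : Fin k, if i < j then (t i - t j) ^ α i j else (1:ℝ))) := by
  have h1 : IsSemialgebraicFunOn ℚ S fun _ => (1 : ℝ) := by
    simpa using isSemialgebraicFunOn_const_ratCast hS 1
  refine (isSemialgebraicFunOn_const_ratCast hS q).fun_mul
    (((IsSemialgebraicFunOn.fun_finsetProd _ hS fun i _ =>
        fun_zpow (isSemialgebraicFunOn_apply hS i) (β i)).fun_mul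
      (IsSemialgebraicFunOn.fun_finsetProd _ hS fun i _ =>
        fun_zpow (h1.fun_sub (isSemialgebraicFunOn_apply hS i)) (γ i))).fun_mul
      (IsSemialgebraicFunOn.fun_finsetProd _ hS fun i _ =>
        IsSemialgebraicFunOn.fun_finsetProd _ hS fun j _ => ?_))
  by_cases hij : i < j
  · simp only [if_pos hij]
    exact fun_zpow ((isSemialgebraicFunOn_apply hS i).fun_sub (isSemialgebraicFunOn_apply hS j)) _
  · simp only [if_neg hij]
    exact h1

/-! ### The stub in dimension `0` and in dimension `n + 1` -/

/-- Dimension `0`: the cube and the simplex are the one-point space and both integrands are the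
constant `q`; the representation itself is the simplicial representation. [folklore] -/
theorem chartBack_zero (q : ℚ) (a : Fin 0 → ℕ) (e : Fin 0 → Fin 0 → ℤ) (s : KZ.IntegralRep 0)
    (hdom : s.domain = {x : Fin 0 → ℝ | ∀ i, x i ∈ Ioo (0:ℝ) 1})
    (hint : EqOn s.integrand (fun x => (q : ℝ) * atomFun a e x) s.domain) :
    ∃ (q' : ℚ) (β γ : Fin 0 → ℤ) (α : Fin 0 → Fin 0 → ℤ) (s' : KZ.IntegralRep 0),
      s'.domain = {t : Fin 0 → ℝ | (∀ i, 0 < t i) ∧ (∀ i, t i < 1) ∧ StrictAnti t} ∧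
      EqOn s'.integrand (fun t => (q' : ℝ) * ((∏ i : Fin 0, t i ^ β i) *
        (∏ i : Fin 0, (1 - t i) ^ γ i) *
        ∏ i : Fin 0, ∏ j : Fin 0, if i < j then (t i - t j) ^ α i j else (1:ℝ))) s'.domain ∧
      KZ.of s - KZ.of s' ∈ KZ.relations := by
  refine ⟨q, fun _ => 0, fun _ => 0, fun _ _ => 0, s, ?_, fun t ht => ?_, ?_⟩
  · rw [hdom]
    ext t
    exact ⟨fun _ => ⟨fun i => i.elim0, fun i => i.elim0, fun i => i.elim0⟩, fun _ i => i.elim0⟩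
  · rw [hint ht]
    simp [atomFun]
  · rw [sub_self]
    exact zero_mem _

/-- Dimension `n + 1`: the simplicial representation `[Δ_{n+1}, q · mono]` (integrability
transported along the chart, semialgebraicity by `isSemialgebraicFunOn_smono`) and the rule-2
move `monomialChart_transport`. [cite: KontsevichZagier2001, §1.2 rule (2)] -/
theorem chartBack_succ (q : ℚ) (a : Fin (n + 1) → ℕ) (e : Fin (n + 1) → Fin (n + 1) → ℤ)
    (s : KZ.IntegralRep (n + 1))
    (hdom : s.domain = {x : Fin (n + 1) → ℝ | ∀ i, x i ∈ Ioo (0:ℝ) 1})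
    (hint : EqOn s.integrand (fun x => (q : ℝ) * atomFun a e x) s.domain) :
    ∃ (q' : ℚ) (β γ : Fin (n + 1) → ℤ) (α : Fin (n + 1) → Fin (n + 1) → ℤ)
      (s' : KZ.IntegralRep (n + 1)),
      s'.domain = {t : Fin (n + 1) → ℝ | (∀ i, 0 < t i) ∧ (∀ i, t i < 1) ∧ StrictAnti t} ∧
      EqOn s'.integrand (fun t => (q' : ℝ) * ((∏ i : Fin (n + 1), t i ^ β i) *
        (∏ i : Fin (n + 1), (1 - t i) ^ γ i) *
        ∏ i : Fin (n + 1), ∏ j : Fin (n + 1), if i < j then (t i - t j) ^ α i j else (1:ℝ)))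
        s'.domain ∧
      KZ.of s - KZ.of s' ∈ KZ.relations := by
  -- the monomial chart `tᵢ = y₀ ⋯ yᵢ` with rows `{j ≤ i}`
  have hS : ∀ i : Fin (n + 1), ∀ j ∈ Finset.univ.filter (fun j => j ≤ i), j ≤ i := fun i j hj =>
    (Finset.mem_filter.mp hj).2
  have hS' : ∀ i : Fin (n + 1), i ∈ Finset.univ.filter (fun j => j ≤ i) := fun i =>
    Finset.mem_filter.mpr ⟨Finset.mem_univ _, le_rfl⟩
  have hD : IsSemialgebraic ℚ {x : Fin (n + 1) → ℝ | ∀ i, x i ∈ Ioo (0:ℝ) 1} :=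
    isSemialgebraic_cube (n + 1)
  have hDm : MeasurableSet {x : Fin (n + 1) → ℝ | ∀ i, x i ∈ Ioo (0:ℝ) 1} :=
    IsSemialgebraic.measurableSet_holds hD
  have himg : cubicalMap (n + 1) '' {x : Fin (n + 1) → ℝ | ∀ i, x i ∈ Ioo (0:ℝ) 1} =
      {t : Fin (n + 1) → ℝ | (∀ i, 0 < t i) ∧ (∀ i, t i < 1) ∧ StrictAnti t} :=
    image_cubicalMap (n + 1)
  have hSimp : IsSemialgebraic ℚ
      {t : Fin (n + 1) → ℝ | (∀ i, 0 < t i) ∧ (∀ i, t i < 1) ∧ StrictAnti t} :=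
    KZ.isSemialgebraic_openOrderedSimplex (n + 1)
  -- the simplicial Laurent monomial
  let h : (Fin (n + 1) → ℝ) → ℝ := fun t =>
    (q : ℝ) * ((∏ i : Fin (n + 1), t i ^
          ((((a i : ℕ) : ℤ) - ((n + 1 - 1 - (i : ℕ) : ℕ) : ℤ)) -
            (Fin.snoc (fun i' : Fin n =>
              ((a i'.succ : ℕ) : ℤ) - ((n + 1 - 1 - (i'.succ : ℕ) : ℕ) : ℤ)) (0:ℤ) :
                Fin (n + 1) → ℤ) i -
            ∑ j : Fin (n + 1), if i < j then
              (Fin.snoc (fun i' : Fin n => e i'.succ j) (0:ℤ) : Fin (n + 1) → ℤ) i else 0)) *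
        (∏ i : Fin (n + 1), (1 - t i) ^ e 0 i) *
        ∏ i : Fin (n + 1), ∏ j : Fin (n + 1), if i < j then
          (t i - t j) ^ (Fin.snoc (fun i' : Fin n => e i'.succ j) (0:ℤ) : Fin (n + 1) → ℤ) i
          else (1:ℝ))
  have hgh : ∀ y ∈ {x : Fin (n + 1) → ℝ | ∀ i, x i ∈ Ioo (0:ℝ) 1},
      (fun x => (q : ℝ) * atomFun a e x) y = h (cubicalMap (n + 1) y) *
        |∏ i, ∏ l ∈ (Finset.univ.filter (fun j => j ≤ i)).erase i, y l| :=
    fun y hy => atom_eq_smono_mul_jacobian q a e hy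
  -- the atom on the cube
  have hintD : EqOn s.integrand (fun x => (q : ℝ) * atomFun a e x)
      {x : Fin (n + 1) → ℝ | ∀ i, x i ∈ Ioo (0:ℝ) 1} := fun y hy => hint (hdom ▸ hy)
  have hgi : IntegrableOn (fun x => (q : ℝ) * atomFun a e x)
      {x : Fin (n + 1) → ℝ | ∀ i, x i ∈ Ioo (0:ℝ) 1} volume :=
    (hdom ▸ s.integrableOn).congr_fun hintD hDm
  -- integrability of the monomial on the simplex, transported along the chart
  have hhi : IntegrableOn h
      {t : Fin (n + 1) → ℝ | (∀ i, 0 < t i) ∧ (∀ i, t i < 1) ∧ StrictAnti t} volume := by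
    have hC := wordAtomChart_integrableOn_image
      (fun i : Fin (n + 1) => Finset.univ.filter (fun j => j ≤ i)) hS hS' hDm (cubicalMap (n + 1))
      (fun _ _ => rfl) (injOn_cubicalMap (n + 1)) (fun x => (q : ℝ) * atomFun a e x) h hgh hgi
    rwa [himg] at hC
  -- the simplicial representation
  let s' : KZ.IntegralRep (n + 1) :=
    { domain := {t : Fin (n + 1) → ℝ | (∀ i, 0 < t i) ∧ (∀ i, t i < 1) ∧ StrictAnti t}
      integrand := h
      isSemialgebraic_domain := hSimp
      isSemialgebraicFunOn_integrand := isSemialgebraicFunOn_smono hSimp q _ _ _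
      integrableOn := hhi }
  refine ⟨q, _, fun i => e 0 i, _, s', rfl, fun _ _ => rfl, ?_⟩
  -- one rule-2 move along the chart
  have hT := monomialChart_transport (fun i : Fin (n + 1) => Finset.univ.filter (fun j => j ≤ i))
    hS hS' hD (cubicalMap (n + 1)) (fun _ _ => rfl) (injOn_cubicalMap (n + 1))
    (fun x => (q : ℝ) * atomFun a e x) h hgh
  exact hT.2 s s' hdom hintD himg.symm (fun _ _ => rfl)

end ChartBack

/-- **stub_chartBack** (line `torus-descent-sum-shadow`, skeleton v6).  The cubical chart read
backwards: a convergent cubical atom `[□ᵏ, q·xᵃ·∏_{i≤j}(1 - x_{[i,j]})^{e i j}]` is congruent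
modulo `KZ.relations` — one change-of-variables move (rule (2)) along `tᵢ = x₀⋯xᵢ`, a polynomial
bijection of the open cube onto the open ordered simplex with Jacobian `∏ xₗ^{k-1-l}` — to the
convergent simplicial Laurent monomial representation
`[Δ_k, q · ∏ tᵢ^{βᵢ} (1 - tᵢ)^{e 0 i} ∏_{i<j} (tᵢ - tⱼ)^{e (i+1) j}]`,
`βᵢ = cᵢ - c_{i+1} - Σ_{j>i} e (i+1) j`, `c_l = a_l - (k-1-l)`, `c_k = 0`.
[cite: KontsevichZagier2001, §1.2 rule (2)] -/
theorem stub_chartBack : ∀ (k : ℕ) (q : ℚ) (a : Fin k → ℕ) (e : Fin k → Fin k → ℤ) (s : Literature.NumberTheory.Transcendental.KZ.IntegralRep k), s.domain = {x : Fin k → ℝ | ∀ i, x i ∈ Set.Ioo (0:ℝ) 1} → Set.EqOn s.integrand (fun x => (q : ℝ) * ((∏ i : Fin k, x i ^ a i) * ∏ i : Fin k, ∏ j : Fin k, if i ≤ j then (1 - (∏ l : Fin k, if i ≤ l ∧ l ≤ j then x l else 1)) ^ e i j else 1)) s.domain → ∃ (q' : ℚ) (β γ : Fin k → ℤ) (α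 : Fin k → Fin k → ℤ) (s' : Literature.NumberTheory.Transcendental.KZ.IntegralRep k), s'.domain = {t : Fin k → ℝ | (∀ i, 0 < t i) ∧ (∀ i, t i < 1) ∧ StrictAnti t} ∧ Set.EqOn s'.integrand (fun t => (q' : ℝ) * ((∏ i : Fin k, t i ^ β i) * (∏ i : Fin k, (1 - t i) ^ γ i) * ∏ i : Fin k, ∏ j : Fin k, if i < j then (t i - t j) ^ α i j else 1)) s'.domain ∧ Literature.NumberTheory.Transcendental.KZ.of s - Literature.NumberTheory.Transcendental.KZ.of s' ∈ Literature.NumberTheory.Transcendental.KZ.relations := by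
  intro k
  cases k with
  | zero =>
    intro q a e s hdom hint
    exact ChartBack.chartBack_zero q a e s hdom hint
  | succ n =>
    intro q a e s hdom hint
    exact ChartBack.chartBack_succ q a e s hdom hint

end Summit.KontsevichZagierPeriods.DihedralNormalForm.TorusDescent

end
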